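import Literature.MathematicalPhysics.QuantumFieldTheory.Balaban1983to89.B9Thm313WholeLeafRelZCutU

/-!
# `Balaban1983to89.B9Thm313WholeLeafRelZCutUE` — T. Bałaban, *Propagators for lattice gauge theories in a background field*, Commun. Math. Phys. **99** (1985) 389–434
# [`Balaban1985BackgroundPropagators`], Theorem 3.13 p. 426 AS PRINTED — the top assembly `B9Thm313WholeLeafRelZCutU.thm313Printed_of_stepRelZcU` CUT AT THE 𝔊-ENTRY LINE:
# the three sup entries (3.42)₁,₂,₃ of 𝔊 and the expansion pin `HasRWExpOfOps` are HYPOTHESES; the (3.47) passage, the relative co-readings, the global entries and the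
# positivity pin are proved as there; NO step `G₀(Δ′_π + Δ⁽²⁾_π)` on a raw sup class is consumed

[4] = T. Bałaban, *Propagators and renormalization transformations for lattice gauge theories. II*, Commun. Math. Phys. **96** (1984) 223–250 [`Balaban1984PropagatorsII`].
statement-level skeleton of published theorems with citation tags; proofs where landed; nothing here is a claim about the Yang–Mills mass gap.

THE PRINT.  Thm 3.13 p. 426 (𝔊 satisfies (3.42)–(3.47)); (3.47) p. 398 (the global entries from the sup majorants by Lemma 2.1's weighted sums); (3.150)–(3.151) p. 425 (positivity).

WHY THIS FILE (cell `pub-ymgap`, node N06, bundle F7 rows 20–21, seat dag-n06-l g27; programme P-U8S step S5e — the row-21 frame of the FLAG №8 (U8) cure).  The landed frame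
derives the entries of 𝔊 by `GG_entry0∕1_cut_of_letters ∕ GG_entry2_of_lettersZc` from `Step.step1` (p = 1, 2), `LeftStep.stepD1` and reads the pin from `hasRWExp_of_schemas`
(again `Step`) — the raw-state species of LOCATED-U8′.  Over the REGULAR state the entries come from `B9Thm313WholeGGEntriesMembers` (members from `B9Thm312WholeStepRegular ∕
…MembersRegular`) and the pin from `B9Thm312WholeSeriesRegular.hasRWExp_of_stepS`; so THIS FILE re-issues the frame with
* `hent` — per member and configuration in the regime: `HasMajorant blk (𝔊 U) (C_e·(Lʲη)²·e^{−ρ′d})`, `HasMajorantHom blk blkY (∇_U∘𝔊) (C_e·Lʲη·e^{−ρ′d})`,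
  `HasMajorantHom blkY blk (𝔊∘∇\*_U) (C_e·Lʲη·e^{−ρ′d})` (ONE constant `C_e ≥ 0`, the rate ρ′ of the (3.47) passage);
* `hpins` — `∀ K δ, HasRWExpOfOps (𝔬 i) K U δ`;
* `hmodel` — `FormSmall ∧ Identities` only (positivity pin);
and everything else (`hres`, the relative co-readings, `hsat ∕ hmult`, `hL21`, the geometry) VERBATIM: ★★ `thm313Printed_of_entriesRelZcU`, conclusion `B9.Thm313Printed …` UNCHANGED.
HONEST SCOPE.  Re-assembly of landed pieces; the entries and pins are HYPOTHESES of printed species; nothing of [B9]∕[4] asserted; no pin, no certificate edit; COUNT-NEUTRAL;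
N06 NOT discharged; nothing continuum ∕ OS positivity ∕ mass gap.  Cell `pub-ymgap` (HUMAN RULING D-0062), Track A node N06 [B9], seat `pub-ymgap-dag-n06-l` (g27), 2026-08-29.
NEW file; nothing landed is modified.
-/

namespace Literature.MathematicalPhysics.QuantumFieldTheory.Balaban1983to89.B9Thm313WholeLeafRelZCutUE

open Literature.MathematicalPhysics.QuantumFieldTheory.Balaban1983to89
open Finset B6RandomWalk B6RandomWalkHom B9Thm34Ext B9Thm37GlueCor36 B11SectG B9SectDSup
open B9Thm37AllNorms B9Thm37AllNormsInstances B9FromB6 B9FromB6ModelSignsOn B9SectBStepWhole B9Thm312Whole B9Thm312WholeLeaf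
open B9Thm312WholeLeft B9Thm313Whole B9Thm313WholeLeft B9Thm312WholeLeafLeftGlob B9Ineq347CoReading B9SectCDiffDict B9CoRealizesRel
open B9Thm313WholeZ B9Thm313WholeLeftZ B9Thm313WholeLeafRelZ B9Thm313WholeRgdFrom3152 B9Thm313WholeLettersCut B9Thm313WholeCutCores
open B9Thm313WholeSupReadersCut B9Thm313WholeLeafRelZCutU

noncomputable section

section Family

variable {I : Type} {c35 : ℝ} {geo : I → B9.Geometry} {bg : I → B9.Backgrounds}
variable [∀ i, Fintype (geo i).Site]
variable {X Y Z W : I → Type} [∀ i, Fintype (X i)] [∀ i, DecidableEq (X i)] [∀ i, Fintype (Y i)]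
  [∀ i, Fintype (Z i)] [∀ i, Fintype (W i)]

omit [∀ i, Fintype (X i)] [∀ i, DecidableEq (X i)] [∀ i, Fintype (Y i)] [∀ i, Fintype (Z i)] [∀ i, Fintype (W i)]
  [∀ i, Fintype (geo i).Site] in
/-- Arithmetic of *"for α₀ sufficiently small"*: t ≧ 0 and m ≦ (2(t + 1))⁻¹ give tm ≦ ½. [folklore] -/
private theorem small_aux_zce {t m : ℝ} (ht : 0 ≤ t) (hm : m ≤ (2 * (t + 1))⁻¹) : t * m ≤ 1 / 2 := by
  have hpos : 0 < 2 * (t + 1) := by linarith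
  have h1 : t * m ≤ t * (2 * (t + 1))⁻¹ := mul_le_mul_of_nonneg_left hm ht
  have h2 : t * (2 * (t + 1))⁻¹ ≤ 1 / 2 := by
    rw [← div_eq_mul_inv, div_le_iff₀ hpos]
    linarith
  linarith

omit [∀ i, DecidableEq (X i)] [∀ i, Fintype (Y i)] in
/-- ★★ **THEOREM 3.13 AS PRINTED, THE FRAME CUT AT THE 𝔊-ENTRY LINE** (`thm313Printed_of_stepRelZcU` with the three sup entries of 𝔊 (`hent`, one constant `C_e`, rate ρ′),
the expansion pin (`hpins`) and `FormSmall ∧ Identities` (`hmodel`) as HYPOTHESES in place of `Thm33G0 ∧ Step 1 ∧ Step 2 ∧ …`, `LeftStep`, the letters and `Ids3152`): the (3.47)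
passage on the model lattice (`maj342` shapes, relative co-readings `hcoR ∕ hco1R`, `clause342_of_hasMajorantHom_rel`), the global entries (`glob_of_hasMajorantHom`, `hcoG`, Lemma
2.1 above ML_g at the rate ρ′ — `hL21`), the residual `hres` (L² block + Hölder inequalities at (B₁, δ₁)) and the positivity pin (`posDefK_of_schemas`), all brought to
(B_out, δ_out) with a₀ = min(a₁, (2(r₁+1))⁻¹): `B9.Thm313Printed …`.
[cite: Balaban1985BackgroundPropagators, Thm 3.13 p.426 + (3.152)–(3.153) p.426 + (3.40)–(3.47) pp.397–398 + (3.150)–(3.151) p.425; Balaban1984PropagatorsII, (2.51)–(2.56) pp.232–233 + Lemma 2.1 (2.60)–(2.61) p.234] -/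
theorem thm313Printed_of_entriesRelZcU (𝔬 : ∀ i, Ops (geo i) (bg i) (X i) (Y i) (Z i) (W i)) (R₀ : I → ℝ) (H₀ : I → Prop)
    (GG : ∀ i, B9.KernelFamily (geo i) (bg i))
    (ev : ∀ i, (geo i).Loc → X i → ℝ) (evY : ∀ i, (geo i).Loc → Y i → ℝ) {P : ∀ i, (geo i).Loc → Prop}
    (Rel : ∀ i, (geo i).Site → (geo i).Site → Prop) [∀ i, DecidableRel (Rel i)] (m : ℕ)
    (r₁ Ce a₁ M₁ B₁ δ₁ ρ' α Lc : ℝ) (Bβ Bε : ℝ → ℝ) (Bεβ : ℝ → ℝ → ℝ)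
    (hr₁ : 0 ≤ r₁) (hCe : 0 ≤ Ce) (hρ' : 0 < ρ') (ha₁ : 0 < a₁) (hM₁ : 0 < M₁) (hδ₁ : 0 < δ₁)
    (hBβ : ∀ β, 0 ≤ Bβ β) (hBε : ∀ ε, 0 ≤ Bε ε) (hBεβ : ∀ ε β, 0 ≤ Bεβ ε β)
    (hgeo : ∀ i, GeoOK (geo i)) (S : ∀ i, ModelSignsOn (geo i) (P i))
    (hL1 : ∀ i, 1 ≤ (geo i).L) (hLle : ∀ i, (geo i).L ≤ Lc) (hη : ∀ i, 0 < (geo i).eta)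
    (hL21 : ∀ δ : ℝ, 0 < δ → ∃ ML' c' : ℝ, Lemma21AboveG geo R₀ H₀ δ α ML' c')
    (hsat : ∀ (i : I) (n : Fin 4) (B' δ' : ℝ),
      (∀ a a' b, Rel i a a' → maj342 (geo i) n B' δ' a b = maj342 (geo i) n B' δ' a' b) ∧
      (∀ a b b', Rel i b b' → maj342 (geo i) n B' δ' a b = maj342 (geo i) n B' δ' a b'))
    (hmult : ∀ (i : I) (y' : (geo i).Site), (Finset.univ.filter (fun y'' => Rel i y'' y')).card ≤ m)
    (hcoR : ∀ (i : I) (U : (bg i).Cfg),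
      CoRealizesRel (GG i) 0 U (Rel i) (𝔬 i).blk (𝔬 i).blk (ev i) ((𝔬 i).GG U) ∧
      CoRealizesRel (GG i) 2 U (Rel i) (𝔬 i).blk (𝔬 i).blkY (evY i) ((𝔬 i).GG U ∘ₗ (𝔬 i).Dstar U))
    (hco1R : ∀ (i : I) (U : (bg i).Cfg), CoRealizesRel (GG i) 1 U (Rel i) (𝔬 i).blkY (𝔬 i).blk (ev i) ((𝔬 i).D U ∘ₗ (𝔬 i).GG U))
    (hcoG : ∀ (i : I) (U : (bg i).Cfg),
      CoReadsGlob (GG i) 0 U (𝔬 i).blk (𝔬 i).blk (ev i) ((𝔬 i).GG U) ∧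
      CoReadsGlob (GG i) 1 U (𝔬 i).blkY (𝔬 i).blk (ev i) ((𝔬 i).D U ∘ₗ (𝔬 i).GG U) ∧
      CoReadsGlob (GG i) 2 U (𝔬 i).blk (𝔬 i).blkY (evY i) ((𝔬 i).GG U ∘ₗ (𝔬 i).Dstar U))
    (hmodel : ∀ i, M₁ ≤ (geo i).M → ∀ α₀ : ℝ, 0 < α₀ → (geo i).M * α₀ ≤ a₁ →
      ∀ U : (bg i).Cfg, (bg i).Reg335 c35 α₀ U → (bg i).Reg336 c35 α₀ U →
        FormSmall (𝔬 i) (r₁ * ((geo i).M * α₀)) U ∧ Identities (𝔬 i) U)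
    (hent : ∀ i, M₁ ≤ (geo i).M → ∀ α₀ : ℝ, 0 < α₀ → (geo i).M * α₀ ≤ a₁ →
      ∀ U : (bg i).Cfg, (bg i).Reg335 c35 α₀ U → (bg i).Reg336 c35 α₀ U →
        HasMajorant (g := toB6 (geo i) (R₀ i) (H₀ i)) (𝔬 i).blk ((𝔬 i).GG U)
            (fun a b => Ce * (geo i).len a ^ 2 * Real.exp (-(ρ' * (geo i).dist a b))) ∧
          HasMajorantHom (g := toB6 (geo i) (R₀ i) (H₀ i)) (𝔬 i).blk (𝔬 i).blkY ((𝔬 i).D U ∘ₗ (𝔬 i).GG U)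
            (fun (a b : (geo i).Site) => Ce * (geo i).len a * Real.exp (-(ρ' * (geo i).dist a b))) ∧
          HasMajorantHom (g := toB6 (geo i) (R₀ i) (H₀ i)) (𝔬 i).blkY (𝔬 i).blk ((𝔬 i).GG U ∘ₗ (𝔬 i).Dstar U)
            (fun (a b : (geo i).Site) => Ce * (geo i).len a * Real.exp (-(ρ' * (geo i).dist a b))))
    (hpins : ∀ i, M₁ ≤ (geo i).M → ∀ α₀ : ℝ, 0 < α₀ → (geo i).M * α₀ ≤ a₁ →
      ∀ U : (bg i).Cfg, (bg i).Reg335 c35 α₀ U → (bg i).Reg336 c35 α₀ U →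
        ∀ (K : B9.KernelFamily (geo i) (bg i)) (δ : ℝ), HasRWExpOfOps (𝔬 i) K U δ)
    (hres : ∀ i, M₁ ≤ (geo i).M → ∀ α₀ : ℝ, 0 < α₀ → (geo i).M * α₀ ≤ a₁ →
      ∀ U : (bg i).Cfg, (bg i).Reg335 c35 α₀ U → (bg i).Reg336 c35 α₀ U →
        L2Block (GG i) B₁ δ₁ U ∧ B9.Ineq343_345 (GG i) Bβ Bε Bεβ δ₁ U) :
    B9.Thm313Printed c35 geo bg GG (fun i => HasRWExpOfOps (𝔬 i)) (fun i => PosDefKOfOps (𝔬 i)) := by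
  -- the constants of the leaf
  obtain ⟨MLg, cg, hLg⟩ := hL21 ρ' hρ'
  set cg' : ℝ := max cg 0 with hcg'
  have hcg'0 : 0 ≤ cg' := le_max_right _ _
  set a₀ : ℝ := min a₁ (2 * (r₁ + 1))⁻¹ with ha₀
  set CsupR : ℝ := (m : ℝ) * Ce with hCsupR
  set Cgl : ℝ := Ce * cg' * Lc ^ (4 : ℝ) with hCgl
  set Bout : ℝ := max (max (max CsupR Cgl) B₁) 1 with hBout
  set δout : ℝ := min ρ' δ₁ with hδout
  have ha₀pos : 0 < a₀ := lt_min ha₁ (inv_pos.mpr (by linarith))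
  have hCsupR0 : 0 ≤ CsupR := mul_nonneg (Nat.cast_nonneg m) hCe
  have hBoutS : CsupR ≤ Bout := ((le_max_left _ _).trans (le_max_left _ _)).trans (le_max_left _ _)
  have hBoutG : Cgl ≤ Bout := ((le_max_right _ _).trans (le_max_left _ _)).trans (le_max_left _ _)
  have hBoutB₁ : B₁ ≤ Bout := (le_max_right _ _).trans (le_max_left _ _)
  have hBout0 : 0 ≤ Bout := zero_le_one.trans (le_max_right _ _)
  have hδρ : δout ≤ ρ' := min_le_left _ _
  have hδδ₁ : δout ≤ δ₁ := min_le_right _ _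
  refine ⟨max M₁ MLg, δout, a₀, Bout, Bβ, Bε, Bεβ, lt_max_of_lt_left hM₁, lt_min hρ' hδ₁,
    ha₀pos, zero_lt_one.trans_le (le_max_right _ _), ?_⟩
  intro i hM α₀ hα₀ hMa U hU hU'
  have hM₁i : M₁ ≤ (geo i).M := (le_max_left _ _).trans hM
  have hMLgi : MLg ≤ (geo i).M := (le_max_right _ _).trans hM
  have hMpos : 0 < (geo i).M := hM₁.trans_le hM₁i
  have hm0 : 0 ≤ (geo i).M * α₀ := (mul_pos hMpos hα₀).le
  have hma₁ : (geo i).M * α₀ ≤ a₁ := hMa.trans (min_le_left _ _)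
  have hmr : (geo i).M * α₀ ≤ (2 * (r₁ + 1))⁻¹ := hMa.trans (min_le_right _ _)
  obtain ⟨hF, hI⟩ := hmodel i hM₁i α₀ hα₀ hma₁ U hU hU'
  obtain ⟨hm0e, hm1e, hm2e⟩ := hent i hM₁i α₀ hα₀ hma₁ U hU hU'
  have hRW := hpins i hM₁i α₀ hα₀ hma₁ U hU hU'
  obtain ⟨hl2, hho⟩ := hres i hM₁i α₀ hα₀ hma₁ U hU hU'
  obtain ⟨h260, hrowg, hsize⟩ := hLg i hMLgi
  have hrowg' : RowSum (toB6 (geo i) (R₀ i) (H₀ i)) ((1 - α) * ρ') cg' := fun y => (hrowg y).trans (le_max_left _ _)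
  have hr : r₁ * ((geo i).M * α₀) < 1 := by
    have h := small_aux_zce hr₁ hmr
    linarith
  obtain ⟨hco0, hco2⟩ := hcoR i U
  have hco1i := hco1R i U
  obtain ⟨hg0, hg1, hg2⟩ := hcoG i U
  have hlen := (hgeo i).lenle
  -- the entries in the `maj342 · n Ce ρ′` shape, for the (3.47) passage on the model lattice
  have hM0 : HasMajorantHom (g := toB6 (geo i) (R₀ i) (H₀ i)) (𝔬 i).blk (𝔬 i).blk ((𝔬 i).GG U) (maj342 (geo i) 0 Ce ρ') :=
    hasMajorantHom_maj342_zero_of_le ((hasMajorantHom_iff (g := toB6 (geo i) (R₀ i) (H₀ i)) (𝔬 i).blk _ _).2 hm0e) le_rfl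
  have hM1 : HasMajorantHom (g := toB6 (geo i) (R₀ i) (H₀ i)) (𝔬 i).blk (𝔬 i).blkY ((𝔬 i).D U ∘ₗ (𝔬 i).GG U) (maj342 (geo i) 1 Ce ρ') :=
    hasMajorantHom_maj342_one_of_le hm1e le_rfl hlen
  have hM2 : HasMajorantHom (g := toB6 (geo i) (R₀ i) (H₀ i)) (𝔬 i).blkY (𝔬 i).blk ((𝔬 i).GG U ∘ₗ (𝔬 i).Dstar U) (maj342 (geo i) 2 Ce ρ') :=
    hasMajorantHom_maj342_two_of_le hm2e le_rfl hlen
  -- the proved clauses (3.42)₁,₂,₃ of 𝔊 at the rate ρ′ with the constant m·C_e, through the RELATIVE co-readings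
  have cl0 : Clause342 (GG i) 0 CsupR ρ' U :=
    clause342_of_hasMajorantHom_rel hco0 hCe hlen (hsat i 0 Ce ρ').1 (hsat i 0 Ce ρ').2 (hmult i) hM0
  have cl1 : Clause342 (GG i) 1 CsupR ρ' U :=
    clause342_of_hasMajorantHom_rel hco1i hCe hlen (hsat i 1 Ce ρ').1 (hsat i 1 Ce ρ').2 (hmult i) hM1
  have cl2 : Clause342 (GG i) 2 CsupR ρ' U :=
    clause342_of_hasMajorantHom_rel hco2 hCe hlen (hsat i 2 Ce ρ').1 (hsat i 2 Ce ρ').2 (hmult i) hM2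
  -- the global entries (3.47)₀,₁,₂ of 𝔊, constant C_e·c′·L⁴ ≦ Bout
  have hL0i : 0 < (geo i).L := lt_of_lt_of_le one_pos (hL1 i)
  have hL4 : (geo i).L ^ (4 : ℝ) ≤ Lc ^ (4 : ℝ) := Real.rpow_le_rpow hL0i.le (hLle i) (by norm_num)
  have hCgl0 : 0 ≤ Ce * cg' * (geo i).L ^ (4 : ℝ) := mul_nonneg (mul_nonneg hCe hcg'0) (Real.rpow_nonneg hL0i.le _)
  have hCglle : Ce * cg' * (geo i).L ^ (4 : ℝ) ≤ Bout := (mul_le_mul_of_nonneg_left hL4 (mul_nonneg hCe hcg'0)).trans hBoutG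
  have hglob : ∀ (n : Fin 4) (lam : (geo i).Loc) (γ : ℝ), n ≠ 3 → -4 ≤ γ → γ ≤ 4 →
      (GG i).glob n U lam γ ≤ Bout * (geo i).wNorm γ lam :=
    glob_noLap_of_entries (PG := fun _ => True) (S i) hCgl0 hCgl0 hCgl0 hCglle hCglle hCglle
      (fun lam γ _ => glob_of_hasMajorantHom hg0 hM0 hCe hcg'0 (hL1 i) (hη i) (S i).wNorm_nonneg hsize h260 hrowg' lam γ)
      (fun lam γ _ => glob_of_hasMajorantHom hg1 hM1 hCe hcg'0 (hL1 i) (hη i) (S i).wNorm_nonneg hsize h260 hrowg' lam γ)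
      (fun lam γ _ => glob_of_hasMajorantHom hg2 hM2 hCe hcg'0 (hL1 i) (hη i) (S i).wNorm_nonneg hsize h260 hrowg' lam γ)
      (fun _ _ _ h => absurd trivial h)
  -- everything brought to (Bout, δout)
  have w : ∀ {j : Fin 4}, Clause342 (GG i) j CsupR ρ' U → Clause342 (GG i) j Bout δout U := fun cm =>
    clause342_mono cm hCsupR0 hBoutS hδρ (S i).dist_nonneg hlen (S i).supNorm_nonneg
  exact ⟨⟨eNoLap_of_clauses (w cl0) (w cl1) (w cl2), l2Block_mono (S i) hl2 hBoutB₁ hBout0 hδδ₁, hglob⟩,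
    ineq343_345_mono (S i) hho (fun _ => le_rfl) hBβ (fun _ => le_rfl) hBε (fun _ _ => le_rfl) hBεβ hδδ₁,
    hRW (GG i) δout, posDefK_of_schemas hr hF hI (GG i)⟩

end Family

end

end Literature.MathematicalPhysics.QuantumFieldTheory.Balaban1983to89.B9Thm313WholeLeafRelZCutUE
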